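import Literature.IUT.LogThetaLattice.PacketLogVolumesHaarModelCapsulesGeneral
import Literature.IUT.LogThetaLattice.PacketLogVolumesHaarModelDegree
import Literature.IUT.LogVolume.TensorPacketLogTransport
import Literature.IUT.LogVolume.PacketDifferent
import HarnessLib

/-!
# [IUTchIII] Proposition 3.9 (iii) for CAPSULES at the genuine model, III: the DEGREE clause — for an
# arithmetic line bundle `𝔍 = {J_v}` placed in the factor `α` of the `A`-packets `⊕_{(v_β)} ⊗_β F_{v_β}`,
# `μ^log_{A,𝕍_ℚ}(𝔍) = deg_F(𝔍)/[F:ℚ]` (`Prop39iii_degree` for every `A` with `|A| ≥ 2`, every label, every number field)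
# (abc-iut cell, layer L6, row «CAP39-deg»; closes the degree half of residual R-iii-tensor of plan/L6/SUBDAG-IUTchIII-Prop-39.md)

S. Mochizuki, *Inter-universal Teichmüller theory III*, kurims manuscript (May 2020), Proposition 3.9 (iii), p. 117
[claim: Mochizuki2012, status: disputed]: "in the case of elements of `(†𝓕⊛_mod)_α` that arise as the image of objects
"`𝔍 = {𝔍_v}_{v∈𝕍}`" of `(†𝓕⊛_𝔪𝔬𝔡)_α` [cf. Example 3.6, (ii); Proposition 3.7, (ii)], the global log-volume
`μ^log_{A,𝕍_ℚ}(𝔍)` is equal to the degree of the arithmetic line bundle determined by `𝔍` …, relative to a suitable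
normalization"; (i), p. 115: "the elements … of "`𝕄(−)`" given by the [products of the] integral structures … on
each of the direct summand … fields … [have] log-volume … equal to zero"; [IUTchIV] Prop. 1.1 (p. 9)
`p^{d_{I*}}·(R_I)^∼ ⊆ R_I`, Prop. 1.4 (i) (p. 13) `μ^log((R_I)^∼) = 0`.

WHAT THIS FILE ADDS (over part II `PacketLogVolumesHaarModelCapsulesGeneral.lean`: `capsulePacketLogVolume F A q` =
`μ^log_{A,v_ℚ}` on GENUINE regions, `portionWeight`, `sum_pi_prod_mul_apply`; and abc-iut-L6-d3 gen 3's `|A| = 1`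
degree file `PacketLogVolumesHaarModelDegree.lean`, p416411: `IdealFamily F` = `𝔍`, `idealRegionAt`,
`haarWeight_mul_logVol_idealRegionAt`, `globalLogVolume_haarIdealRegion = deg_F/[F:ℚ]`):
* **`isCompact_normalizedPacket_of_two_le`** — for `|I| ≥ 2` slots of the cell's `p`-adic field class, the integral
  structure `(R_I)^∼ ⊆ ⊗_{ℚ_p} k_i` IS COMPACT: [IUTchIV] Prop. 1.1 `(⊗_i δ_i)·(R_I)^∼ ⊆ R_I` (campaign-S `prop11_holds` +
  `purePacket_generators_mul_mem_integerPacket`, generators `δ_i` of the differents by `exists_different_eq_span`) fed to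
  abc-iut-S7's `isCompact_normalizedPacket_of` — so Mochizuki's normalisation `μ^log((R_I)^∼) = 0` is HONEST at the
  genuine portions and `(R_I)^∼` is an admissible region (`nonarchUnitRegion`, log-volume `0`);
* `unifAt F v` / `idealGenAt F v n = ϖ_v^{-n}` — GLOBAL uniformizer powers (campaign-S `exists_ord_eq_one`),
  `‖ϖ_v^{-n}‖_v = q_v^{n}` (`log_adicAbv_idealGenAt`);
* the REGION OF `𝔍` IN THE LABEL `α` (`capsuleIdealRegionAt`/`capsuleIdealRegion`): at a finite `v_ℚ = p`, portion
  `π = (v_β)_β`: `ι_α(ϖ_{v_α}^{-n_{v_α}})·(R_I)^∼ ⊆ ⊗_β F_{v_β}` — the image `(⊗_{β≠α}𝒪) ⊗ J_{v_α}` of the fractional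
  ideal `J_{v_α} = 𝔭^{-n}𝒪` in the factor `α`; at `∞`: `(⊗_β m_β)·B_I ⊆ ⊗_{β,ℝ}ℂ`, `m_α = e^{t_{w_α}}`, `m_β = 1` — the
  dilated unit polydisc; their portion log-volumes are `n_{v_α}·log q_{v_α}/[F_{v_α}:ℚ_p]` resp. `t_{w_α}`
  (`portionDatum_logVol_capsuleIdealRegionAt`);
* **`capsulePacketLogVolume_capsuleIdealRegion`**: at every `v_ℚ` the `A`-packet log-volume of `𝔍`-in-label-`α` EQUALS the
  `|A| = 1` packet log-volume of p416411's region of `𝔍` (`sum_pi_prod_mul_apply`), hence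
  **`globalLogVolume_capsuleIdealRegion : μ^log_{A,𝕍_ℚ}(𝔍) = deg_F(𝔍)/[F:ℚ]`** (`= ndeg`), and
  **`prop39iii_degree_haarModelCapsules_general hA α : Prop39iii_degree (capsulePacketLogVolume F A)
  (capsuleIdealRegion F A hA α) IdealFamily.deg`** with the normalisation constant `c = 1/[F:ℚ]` — the SAME constant as
  for `|A| = 1` (p416411) and for every `A`: the "suitable normalization" is independent of the capsule size at the
  genuine model (abc-iut-w4-d035's d035-F1 / `prop39iii_degree_capsuleModel₁`, now a theorem of genuine regions).

HONEST SCOPE. `K = F_mod = F`; `|A| ≥ 2` (hypothesis `hA`; `|A| = 1` is p416411); `⊗_ℝ` of copies of `ℂ` at `∞` (faithful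
for totally complex `F`); the objects `𝔍` are families of fractional ideals / dilated discs (the objects of Example 3.6
(ii) — no Frobenioid is constructed); nothing here bears on [IUTchIII] Cor. 3.12 or takes a side; typed ≠ endorsed.
Classical mathematics. [cite: DupuyHilado2025, §3.7] [cite: Mochizuki2012, IUTchIV Prop. 1.1 p. 9]
-/

noncomputable section

namespace Literature.IUT.LogThetaLattice

open Literature.IUT.LogVolume Literature.NumberTheory.NumberFields NumberField IsDedekindDomain MeasureTheory Set
open scoped ENNReal NNReal Pointwise TensorProduct

/-! ### `(R_I)^∼` is compact for `|I| ≥ 2` ([IUTchIV] Prop. 1.1) -/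

section Compact

variable (p : ℕ) [Fact p.Prime] {I : Type} [Fintype I] [DecidableEq I] [Nonempty I]
variable (k : I → Type) [∀ i, NontriviallyNormedField (k i)] [∀ i, NormedAlgebra ℚ_[p] (k i)]
  [∀ i, IsUltrametricDist (k i)] [∀ i, ProperSpace (k i)]

/-- **`(R_I)^∼` is compact** for `|I| ≥ 2`: with generators `δ_i` of the different ideals, `⊗_i δ_i` is a unit of
`V = ⊗ k_i` and `(⊗_i δ_i)·(R_I)^∼ ⊆ R_I` ([IUTchIV] Prop. 1.1, campaign-S `prop11_holds` in the all-`δ` form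
`purePacket_generators_mul_mem_integerPacket`), so `(R_I)^∼` is a closed subset of the compact `(⊗δ_i)⁻¹·R_I`
(abc-iut-S7's `isCompact_normalizedPacket_of`). [cite: Mochizuki2012, IUTchIV Prop. 1.1 p. 9] -/
theorem isCompact_normalizedPacket_of_two_le (hI : 2 ≤ Fintype.card I) :
    IsCompact (normalizedPacket p k : Set (PacketAlgebra p k)) := by
  choose δ hδ using fun i => exists_different_eq_span p (k i)
  have hδ0 : ∀ i, (δ i : k i) ≠ 0 := fun i => (norm_generator_different p (k i) (hδ i)).1
  have hunit : IsUnit (purePacket p k (fun i => (δ i : k i))) := by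
    rw [← prod_iota_eq_purePacket]
    exact IsUnit.prod_univ_iff.mpr fun i => (IsUnit.mk0 _ (hδ0 i)).map (iota p k i)
  exact isCompact_normalizedPacket_of p k hunit
    (fun x hx => purePacket_generators_mul_mem_integerPacket p k (prop11_holds p k) hI hδ hx)

/-- Hence `(R_I)^∼` has positive finite Haar measure (it is a compact open subring).
[cite: Mochizuki2012, IUTchIV Prop. 1.4 (i) p. 13] -/
theorem haar_normalizedPacket_pos_lt_top (hI : 2 ≤ Fintype.card I) :
    0 < (integerStructure p k).haar (normalizedPacket p k : Set (PacketAlgebra p k)) ∧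
      (integerStructure p k).haar (normalizedPacket p k : Set (PacketAlgebra p k)) < ∞ :=
  ⟨(integerStructure p k).haar_pos_of_isOpen (isOpen_normalizedPacket p k) ⟨1, (normalizedPacket p k).one_mem⟩,
    (integerStructure p k).haar_lt_top_of_isCompact (isCompact_normalizedPacket_of_two_le p k hI)⟩

end Compact

variable (F : Type) [Field F] [NumberField F]
variable (A : Type) [Fintype A] [DecidableEq A] [Nonempty A]

/-! ### Global uniformizer powers `ϖ_v^{-n} ∈ F^×` -/

/-- An element of `ord_v = 1` is nonzero (`ord_v(0) = 0` by the tree's junk convention). [cite: NeukirchANT1999, Ch. I §11] -/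
theorem ne_zero_of_ord_eq_one {v : HeightOneSpectrum (𝓞 F)} {π : F} (h : ord F v π = 1) : π ≠ 0 := by
  rintro rfl
  rw [ord_zero] at h
  exact zero_ne_one h

/-- A chosen GLOBAL uniformizer `ϖ_v ∈ F^×` at `v` (`ord_v(ϖ_v) = 1`; campaign-S `exists_ord_eq_one`, from Mathlib's
`valuation_exists_uniformizer`). [cite: NeukirchANT1999, Ch. I §11] -/
def unifAt (v : HeightOneSpectrum (𝓞 F)) : Fˣ :=
  Units.mk0 (Classical.choose (Literature.IUT.LogVolume.exists_ord_eq_one F v))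
    (ne_zero_of_ord_eq_one F (Classical.choose_spec (Literature.IUT.LogVolume.exists_ord_eq_one F v)))

/-- `ord_v(ϖ_v) = 1`. [cite: NeukirchANT1999, Ch. I §11] -/
theorem ord_unifAt (v : HeightOneSpectrum (𝓞 F)) : ord F v (unifAt F v : F) = 1 :=
  Classical.choose_spec (Literature.IUT.LogVolume.exists_ord_eq_one F v)

/-- `ord_v` of an integer power of a unit. [cite: NeukirchANT1999, Ch. I §11] -/
theorem ord_units_zpow (v : HeightOneSpectrum (𝓞 F)) (u : Fˣ) (n : ℤ) :
    ord F v ((u ^ n : Fˣ) : F) = n * ord F v (u : F) := by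
  rcases n with n | n
  · rw [Int.ofNat_eq_natCast, zpow_natCast, Units.val_pow_eq_pow_val, ord_pow]
  · rw [zpow_negSucc, Units.val_inv_eq_inv_val, ord_inv, Units.val_pow_eq_pow_val, ord_pow, Int.negSucc_eq]
    push_cast
    ring

/-- The generator `ϖ_v^{-n} ∈ F^×` of the fractional ideal `J_v = 𝔭_v^{-n}𝒪_v` (as a global element).
[claim: Mochizuki2012, status: disputed] -/
def idealGenAt (v : HeightOneSpectrum (𝓞 F)) (n : ℤ) : Fˣ := unifAt F v ^ (-n)

/-- `ord_v(ϖ_v^{-n}) = -n`. [claim: Mochizuki2012, status: disputed] -/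
theorem ord_idealGenAt (v : HeightOneSpectrum (𝓞 F)) (n : ℤ) : ord F v (idealGenAt F v n : F) = -n := by
  rw [idealGenAt, ord_units_zpow, ord_unifAt, mul_one]

/-- **`log‖ϖ_v^{-n}‖_v = n·log q_v`** (`‖x‖_v = q_v^{-ord_v(x)}`, campaign-S `adicAbv_eq_absNorm_zpow`).
[claim: Mochizuki2012, status: disputed] -/
theorem log_adicAbv_idealGenAt (v : HeightOneSpectrum (𝓞 F)) (n : ℤ) :
    Real.log (NumberField.HeightOneSpectrum.adicAbv F v (idealGenAt F v n : F)) = n * logNorm F v := by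
  rw [adicAbv_eq_absNorm_zpow F v (idealGenAt F v n).ne_zero, ord_idealGenAt, neg_neg, Real.log_zpow, logNorm]

/-! ### The region of `𝔍` in the label `α`: finite portions -/

section Nonarch

variable (p : Nat.Primes) [Fact (p : ℕ).Prime] (vA : A → {v : HeightOneSpectrum (𝓞 F) // v ∈ placesOver F (p : ℕ)})

/-- **The integral structure `(R_I)^∼ ⊆ ⊗_β F_{v_β}` as an admissible region** (`|A| ≥ 2`: compact open by
`isCompact_normalizedPacket_of_two_le`) — "the elements of "`𝕄(−)`" given by the [products of the] integral structures
… on each of the direct summand … fields" ([IUTchIII] Prop. 3.9 (i) p. 115). [claim: Mochizuki2012, status: disputed] -/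
def nonarchUnitRegion (hA : 2 ≤ Fintype.card A) : (nonarchPortion F A p vA).Adm :=
  ⟨(normalizedPacket p (fun α => Kp F p (vA α)) : Set (PacketAlgebra p (fun α => Kp F p (vA α)))),
    haar_normalizedPacket_pos_lt_top p (fun α => Kp F p (vA α)) hA⟩

/-- Its log-volume is `0` — "log-volume … equal to zero" (campaign-S `tensorLogVolume_normalizedPacket`, honest since
`(R_I)^∼` is compact). [claim: Mochizuki2012, status: disputed] -/
theorem nonarchPortion_logVol_unitRegion (hA : 2 ≤ Fintype.card A) :
    (nonarchPortion F A p vA).logVol (nonarchUnitRegion F A p vA hA).1 = 0 :=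
  tensorLogVolume_normalizedPacket p (fun α => Kp F p (vA α))

/-- **The region of `J = 𝔭_{v_α}^{-n}𝒪` in the label `α` of the portion `⊗_β F_{v_β}`**: `ι_α(ϖ_{v_α}^{-n})·(R_I)^∼`
(the tensor product of the integral structures of the other factors with `J` in the factor `α`).
[claim: Mochizuki2012, status: disputed] -/
def nonarchIdealPortionRegion (hA : 2 ≤ Fintype.card A) (α : A) (n : ℤ) : (nonarchPortion F A p vA).Adm :=
  (nonarchPortion F A p vA).actAdm α (idealGenAt F (vA α).1 n) (nonarchUnitRegion F A p vA hA)

/-- Its log-volume: `μ^log(ι_α(ϖ^{-n})·(R_I)^∼) = n·log q_{v_α}/[F_{v_α}:ℚ_p]` (dimension-normalised `μ^log`).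
[claim: Mochizuki2012, status: disputed] -/
theorem nonarchPortion_logVol_idealPortionRegion (hA : 2 ≤ Fintype.card A) (α : A) (n : ℤ) :
    (nonarchPortion F A p vA).logVol (nonarchIdealPortionRegion F A p vA hA α n).1 =
      n * logNorm F (vA α).1 / localDegree F (vA α).1 := by
  rw [nonarchIdealPortionRegion, CapsuleDatum.logVol_actAdm, nonarchPortion_logVol_unitRegion, zero_add,
    nonarchPortion_shift, log_adicAbv_idealGenAt]

end Nonarch

/-! ### The region of `𝔍` in the label `α`: archimedean portions -/

section Arch

open Literature.IUT.LogVolume.Prop15iii Literature.IUT.LogVolume.ArchPacket PiTensorProduct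

variable (wA : A → InfinitePlace F)

/-- The pure tensor dilating the factor `α` by the positive real `e^t`: `m_α = e^t`, `m_β = 1` (`β ≠ α`).
[claim: Mochizuki2012, status: disputed] -/
def archDilate (α : A) (t : ℝ) : A → M Unit := fun β _ => if β = α then (Real.exp t : ℂ) else 1

omit [Fintype A] [Nonempty A] in
/-- All entries of the dilating tensor are nonzero. [claim: Mochizuki2012, status: disputed] -/
theorem archDilate_ne_zero (α : A) (t : ℝ) (β : A) (u : Unit) : archDilate A α t β u ≠ 0 := by
  unfold archDilate
  split_ifs
  · exact_mod_cast (Real.exp_pos t).ne'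
  · exact one_ne_zero

omit [Nonempty A] in
/-- `Σ_β log|m_β| = t`. [claim: Mochizuki2012, status: disputed] -/
theorem sum_log_norm_archDilate (α : A) (t : ℝ) (g : A → Unit) :
    ∑ β, Real.log ‖archDilate A α t β (g β)‖ = t := by
  have h : ∀ β, Real.log ‖archDilate A α t β (g β)‖ = if β = α then t else 0 := by
    intro β
    unfold archDilate
    split_ifs with hβ
    · rw [Complex.norm_real, Real.norm_eq_abs, abs_of_pos (Real.exp_pos t), Real.log_exp]
    · rw [norm_one, Real.log_one]
  simp_rw [h]
  rw [Finset.sum_ite_eq' Finset.univ α, if_pos (Finset.mem_univ α)]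

omit [NumberField F] in
/-- **The region of `J_w = e^{t}·𝒪_ℂ` in the label `α` of the portion `⊗_{β,ℝ}ℂ`**: the unit polydisc `B_I` dilated by
`e^t` in the factor `α`, `(⊗_β m_β)·B_I`; admissible (the image in the canonical coordinates is a coordinatewise
dilate of the unit polydisc). [claim: Mochizuki2012, status: disputed] -/
def archIdealPortionRegion (α : A) (t : ℝ) : (archPortion F A wA).Adm :=
  ⟨(fun x => tprod ℝ (archDilate A α t) * x) '' ball (canonicalDecomposition A Unit), by
    haveI : Nonempty Unit := ⟨()⟩
    have hball : volume ((canonicalDecomposition A Unit : MI A Unit → (Idx A Unit → ℂ)) ''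
        ball (canonicalDecomposition A Unit)) ≠ 0 ∧
        volume ((canonicalDecomposition A Unit : MI A Unit → (Idx A Unit → ℂ)) ''
          ball (canonicalDecomposition A Unit)) ≠ ∞ := by
      rw [image_ball]
      exact ⟨(volume_unitBall_pos _).ne', (volume_unitBall_lt_top _).ne⟩
    have hc : ∀ idx : Idx A Unit, canonicalDecomposition A Unit (tprod ℝ (archDilate A α t)) idx ≠ 0 :=
      fun idx => (log_norm_canonicalDecomposition_tprod (archDilate A α t) (archDilate_ne_zero A α t) idx).1
    have hprod : 0 < ∏ idx : Idx A Unit, ‖canonicalDecomposition A Unit (tprod ℝ (archDilate A α t)) idx‖ ^ 2 :=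
      Finset.prod_pos fun idx _ => pow_pos (norm_pos_iff.mpr (hc idx)) 2
    show volume (_ '' ((fun x => tprod ℝ (archDilate A α t) * x) '' _)) ≠ 0 ∧
      volume (_ '' ((fun x => tprod ℝ (archDilate A α t) * x) '' _)) ≠ ∞
    rw [image_mul_eq_coordMul, volume_image_coordMul]
    refine ⟨mul_ne_zero ?_ hball.1, ENNReal.mul_ne_top ENNReal.ofReal_ne_top hball.2⟩
    rwa [Ne, ENNReal.ofReal_eq_zero, not_le]⟩

omit [NumberField F] in
/-- Its log-volume is `t` (`packetLogVol((⊗m)·B_I) = (1/|Idx|)·Σ_idx Σ_β log|m_β| + packetLogVol(B_I) = t + 0`).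
[claim: Mochizuki2012, status: disputed] -/
theorem archPortion_logVol_idealPortionRegion (α : A) (t : ℝ) :
    (archPortion F A wA).logVol (archIdealPortionRegion F A wA α t).1 = t := by
  haveI : Nonempty Unit := ⟨()⟩
  have hball : volume ((canonicalDecomposition A Unit : MI A Unit → (Idx A Unit → ℂ)) ''
      ball (canonicalDecomposition A Unit)) ≠ 0 ∧
      volume ((canonicalDecomposition A Unit : MI A Unit → (Idx A Unit → ℂ)) ''
        ball (canonicalDecomposition A Unit)) ≠ ∞ := by
    rw [image_ball]
    exact ⟨(volume_unitBall_pos _).ne', (volume_unitBall_lt_top _).ne⟩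
  show packetLogVol (canonicalDecomposition A Unit)
      ((fun x => tprod ℝ (archDilate A α t) * x) '' ball (canonicalDecomposition A Unit)) = t
  rw [packetLogVol_image_tprod_mul (archDilate A α t) (archDilate_ne_zero A α t) hball.1 hball.2, packetLogVol_ball,
    add_zero]
  simp_rw [sum_log_norm_archDilate]
  rw [Finset.sum_const, Finset.card_univ, nsmul_eq_mul, ← mul_assoc,
    inv_mul_cancel₀ (by exact_mod_cast Fintype.card_ne_zero), one_mul]

end Arch

/-! ### The region of `𝔍` in the label `α` at every `v_ℚ`, and its `A`-packet log-volume -/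

/-- The per-place term of the degree in the dimension-normalised convention: `t_w` at an archimedean `w`,
`n_v·log q_v/[F_v:ℚ_p]` at a finite `v`. [claim: Mochizuki2012, status: disputed] -/
def idealTerm (J : IdealFamily F) : Place F → ℝ :=
  Sum.elim (fun w => J.arch w) (fun v => (J.fin v : ℝ) * logNorm F v / localDegree F v)

/-- **Weight × term is p416411's summand**: `placeProbWeight F v · idealTerm J v = haarWeight F v · μ^log_v(J_v)` — at a
finite `v`: `(n_v/[F:ℚ])·(n·log q_v/n_v) = (1/[F:ℚ])·n·log q_v`; at an archimedean `w`: `([F_w:ℝ]/[F:ℚ])·t`.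
[claim: Mochizuki2012, status: disputed] -/
theorem placeProbWeight_mul_idealTerm (J : IdealFamily F) (v : Place F) :
    placeProbWeight F v * idealTerm F J v = haarWeight F v * (placeDatum F v).logVol (idealRegionAt F J v).1 := by
  rw [haarWeight_mul_logVol_idealRegionAt]
  rcases v with w | v
  · simp [idealTerm, placeProbWeight]
    ring
  · simp only [placeProbWeight_inr, idealTerm, Sum.elim_inr, IdealFamily.toADivisor_inr, degWeight_inr]
    have hn : (localDegree F v : ℝ) ≠ 0 := by exact_mod_cast (localDegree_pos F v).ne'
    field_simp

variable (hA : 2 ≤ Fintype.card A)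

/-- **The region of `𝔍` in the label `α` of the portion `π` at `v_ℚ`** (`ι_α(ϖ^{-n})·(R_I)^∼` at `p`, `(⊗m)·B_I` at `∞`).
[claim: Mochizuki2012, status: disputed] -/
def capsuleIdealRegionAt (α : A) (J : IdealFamily F) :
    (q : RatPlace) → (π : Portion F A q) → (portionDatum F A q π).Adm
  | Sum.inl (), π => archIdealPortionRegion F A (fun β => packetInftyEquiv F (π β)) α (J.arch (packetInftyEquiv F (π α)))
  | Sum.inr p, π =>
      haveI : Fact (p : ℕ).Prime := ⟨p.2⟩
      nonarchIdealPortionRegion F A p (fun β => packetPrimeEquiv F p (π β)) hA α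
        (J.fin (packetPrimeEquiv F p (π α)).1)

/-- **Its portion log-volume is the per-place term at `π(α)`**. [claim: Mochizuki2012, status: disputed] -/
theorem portionDatum_logVol_capsuleIdealRegionAt (α : A) (J : IdealFamily F) (q : RatPlace) (π : Portion F A q) :
    (portionDatum F A q π).logVol (capsuleIdealRegionAt F A hA α J q π).1 = idealTerm F J (π α).1 := by
  rcases q with ⟨⟩ | p
  · show (archPortion F A _).logVol (archIdealPortionRegion F A _ α _).1 = _
    rw [archPortion_logVol_idealPortionRegion]
    generalize π α = v
    rcases v with ⟨w | w, h⟩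
    · rfl
    · exact absurd h (ratPlaceBelow_inr_ne_infty F w)
  · haveI : Fact (p : ℕ).Prime := ⟨p.2⟩
    show (nonarchPortion F A p _).logVol (nonarchIdealPortionRegion F A p _ hA α _).1 = _
    rw [nonarchPortion_logVol_idealPortionRegion]
    generalize π α = v
    rcases v with ⟨w | w, h⟩
    · exact absurd h (ratPlaceBelow_inl_ne_prime F w p)
    · rfl

/-- **At every `v_ℚ` the `A`-packet log-volume of `𝔍`-in-label-`α` equals the `|A| = 1` packet log-volume of `𝔍`**
(p416411's `haarIdealRegion`): `Σ_π (∏_β ω(π β))·term(π α) = Σ_v ω_v·term_v = Σ_v c_v·μ^log_v(J_v)`.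
[claim: Mochizuki2012, status: disputed] -/
theorem capsulePacketLogVolume_capsuleIdealRegionAt (α : A) (J : IdealFamily F) (q : RatPlace) :
    capsulePacketLogVolume F A q (capsuleIdealRegionAt F A hA α J q) =
      haarPacketLogVolume F q ((haarIdealRegion F J).1 q) := by
  unfold capsulePacketLogVolume portionWeight
  simp_rw [portionDatum_logVol_capsuleIdealRegionAt]
  rw [sum_pi_prod_mul_apply A (fun v : Packet F q => placeProbWeight F v.1) (fun v => idealTerm F J v.1)
    (sum_packet_placeProbWeight F q) α]
  simp only [haarPacketLogVolume, haarIdealRegion_apply]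
  exact Finset.sum_congr rfl fun v _ => placeProbWeight_mul_idealTerm F J v.1

/-- **The region of `𝔍` in the label `α`** as a GLOBAL region of the `A`-packets ("zero log-volume for all but finitely
many `v_ℚ`": its packet log-volumes are those of p416411's `haarIdealRegion`). [claim: Mochizuki2012, status: disputed] -/
def capsuleIdealRegion (α : A) (J : IdealFamily F) : GlobalRegion (capsulePacketLogVolume F A) :=
  ⟨capsuleIdealRegionAt F A hA α J, by
    have h := (haarIdealRegion F J).2
    refine h.subset fun q hq => ?_
    rw [Function.mem_support, capsulePacketLogVolume_capsuleIdealRegionAt] at hq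
    exact Function.mem_support.mpr hq⟩

/-- **`μ^log_{A,𝕍_ℚ}(𝔍) = μ^log_{𝕍_ℚ}(𝔍)`**: the global log-volume of `𝔍` placed in the label `α` of the `A`-packets is its
`|A| = 1` global log-volume. [claim: Mochizuki2012, status: disputed] -/
theorem globalLogVolume_capsuleIdealRegion_eq (α : A) (J : IdealFamily F) :
    globalLogVolume (capsulePacketLogVolume F A) (capsuleIdealRegion F A hA α J) =
      globalLogVolume (haarPacketLogVolume F) (haarIdealRegion F J) := by
  unfold globalLogVolume
  exact finsum_congr fun q => capsulePacketLogVolume_capsuleIdealRegionAt F A hA α J q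

/-- **`μ^log_{A,𝕍_ℚ}(𝔍) = deg_F(𝔍)/[F:ℚ]`** for every `A` (`|A| ≥ 2`) and every label `α` (p416411
`globalLogVolume_haarIdealRegion`). [claim: Mochizuki2012, status: disputed] -/
theorem globalLogVolume_capsuleIdealRegion (α : A) (J : IdealFamily F) :
    globalLogVolume (capsulePacketLogVolume F A) (capsuleIdealRegion F A hA α J) = J.deg / Module.finrank ℚ F := by
  rw [globalLogVolume_capsuleIdealRegion_eq, globalLogVolume_haarIdealRegion]

/-- The same with the tree's normalised degree `ndeg` ([IUTchIV] Def. 1.9 (i)): `μ^log_{A,𝕍_ℚ}(𝔍) = deg(𝔞_𝔍)` on the nose.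
[claim: Mochizuki2012, status: disputed] -/
theorem globalLogVolume_capsuleIdealRegion_eq_ndeg (α : A) (J : IdealFamily F) :
    globalLogVolume (capsulePacketLogVolume F A) (capsuleIdealRegion F A hA α J) = ndeg F J.toADivisor := by
  rw [globalLogVolume_capsuleIdealRegion_eq, globalLogVolume_haarIdealRegion_eq_ndeg]

/-- **IUTchIII:Prop3.9(iii)** (kurims p. 117) DEGREE CLAUSE AT THE GENUINE MODEL FOR CAPSULES: for every finite label
set `A` with `|A| ≥ 2` and every label `α ∈ A`, abc-iut-L6-t4's `Prop39iii_degree (capsulePacketLogVolume F A)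
(capsuleIdealRegion F A hA α) IdealFamily.deg` HOLDS with the normalisation constant `c = 1/[F:ℚ]` — the SAME constant as
at `|A| = 1` (p416411 `prop39iii_degree_haarModel`): "the global log-volume `μ^log_{A,𝕍_ℚ}(𝔍)` is equal to the degree of
the arithmetic line bundle determined by `𝔍` …, relative to a suitable normalization", the normalization being
INDEPENDENT of the capsule (abc-iut-w4-d035's d035-F1 at genuine regions). [claim: Mochizuki2012, status: disputed] -/
theorem prop39iii_degree_haarModelCapsules_general (α : A) :
    Prop39iii_degree (capsulePacketLogVolume F A) (capsuleIdealRegion F A hA α) IdealFamily.deg :=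
  ⟨1 / Module.finrank ℚ F, div_pos one_pos (FinDivisor.finrank_pos (F := F)), fun J => by
    rw [globalLogVolume_capsuleIdealRegion, one_div, ← div_eq_inv_mul]⟩

/-- The unit family `𝒪 = {𝒪_v}` in any label has global log-volume `0` ("the log-volume of [the integral structures]
… is equal to zero", Prop. 3.9 (i)). [claim: Mochizuki2012, status: disputed] -/
theorem globalLogVolume_capsuleIdealRegion_unit (α : A) :
    globalLogVolume (capsulePacketLogVolume F A) (capsuleIdealRegion F A hA α IdealFamily.unit) = 0 := by
  rw [globalLogVolume_capsuleIdealRegion_eq, globalLogVolume_haarIdealRegion_unit]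

/-- **Both clauses of Prop. 3.9 (iii) together at the genuine capsule model**: multiplying the region of `𝔍` in the label
`β` by `f ∈ F^×` in ANY label `γ` leaves its global log-volume `deg_F(𝔍)/[F:ℚ]` unchanged (part II
`prop39iii_invariance_haarModelCapsules_general`). [claim: Mochizuki2012, status: disputed] -/
theorem globalLogVolume_capsulePacketAction_capsuleIdealRegion (β γ : A) (f : Fˣ) (J : IdealFamily F) :
    globalLogVolume (capsulePacketLogVolume F A) (capsulePacketAction F A γ f (capsuleIdealRegion F A hA β J)) =
      J.deg / Module.finrank ℚ F := by
  rw [globalLogVolume_capsulePacketAction, globalLogVolume_capsuleIdealRegion]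

end Literature.IUT.LogThetaLattice

end
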